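import Mathlib
import Literature.Dynamics.Contraction.ComplexConeContraction
import Summits.CriticalPhenomena.CardyFormulaZ2.Theses.CardyComplexCone
import Summits.CriticalPhenomena.CardyFormulaZ2.Theorems.CardyComplexConeComplexConeContractionCone
import Summits.CriticalPhenomena.CardyFormulaZ2.Theorems.CardyComplexConeComplexConeContractionRowPairs
import Summits.CriticalPhenomena.CardyFormulaZ2.Theorems.CardyComplexConeComplexConeContractionBirkhoff
import Summits.CriticalPhenomena.CardyFormulaZ2.Theorems.CardyComplexConeComplexConeContractionDiameter

/-!
# `ComplexConeContraction` (item stmt-CriticalPhenomena-8789, route CardyComplexCone): proof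

We prove the route declaration
`Summit.CriticalPhenomena.CardyFormulaZ2.Theses.CardyComplexCone.ComplexConeContraction`
("THE ENGINE"): for `θ ∈ (0,1)` (and any `σ ≥ 1`) there are `C ≥ 0`, `r ∈ [0,1)` such that for every
sequence of complex matrices `A_j : ℂ^{n_j} → ℂ^{n_{j+1}}` (`n_j ≥ 1`) satisfying Dubois' aperture
condition `θ⁻¹ |a_kp a_lq − a_kq a_lp| < Re(conj(a_kp) a_lq + conj(a_kq) a_lp)`, every two
trajectories started in Rugh's cone `ℂ₊^{n_0} ∖ {0}` have all test-vector cross-ratios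
`⟨f,x_m⟩⟨g,y_m⟩/(⟨f,y_m⟩⟨g,x_m⟩) = 1 + O(r^m)`, `m ≥ 1`, uniformly in the dimensions.

Section `Step` runs the proof of Dubois 2009, Theorem 2.3 (contraction principle), for one
rectangular matrix `A : ℂⁿ → ℂᵐ` with `C₁ = Int ℂⁿ₊`, `C₂ = Int ℂᵐ₊` and the uniform ratio bound
`Λ = (1+K)⁴`, `K = ((1+θ)/(1−θ))³`, of `duboisE_mulVec_ratio_bound` (helper file `…Diameter`) in
place of `e^Δ`: `duboisE_mulVec_subset` (`E(Ax,Ay) ⊆ E(x,y)`), `moebius_ineq` (inequality (2.12) via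
the Möbius map `h(z) = (zλ − μ)/(z − 1)`), `cross_ineq` ((2.13) after `m ↑ a`, `M ↓ b`, with
`λ = (m/|α|) α`, `μ = (M/|β|) β`), `contraction_step` (with Birkhoff's inequality `birkhoff_sqrt`:
an annulus `[p², q²] ⊇ E(x,y)` is mapped to `[P², Q²] ⊇ E(Ax,Ay)` with
`(Q−P)/(Q+P) ≤ c (q−p)/(q+p)`, `c = (L−1)/(L+1)`, `L = (1+K)²`, i.e. `tanh(δ/4)` contracts by
`tanh(Δ/4)` as in Remark 1 of the paper), `base_annulus` (first step from `ℂⁿ₊ ∖ {0}`).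

The main theorem then shows by induction on `j ≥ 1` that `x_j, y_j ∈ Int ℂ₊^{n_j}` and
`E(x_j, y_j) ⊆ {p² ≤ |z| ≤ q²}` with `q − p ≤ c^j (q + p)`; the ratios `z_f = ⟨f,y_m⟩/⟨f,x_m⟩`,
`z_g` lie in `E(x_m,y_m)` (`pairing_ratio_mem_duboisE`), any two points of which are within
`3(q² − p²)` (`norm_sub_le_three_mul`, chain of three discs of Lemma 3.2), whence
`|z_g/z_f − 1| ≤ 3(q² − p²)/p² ≤ 12 c^m/(1−c)²`: `C = 12/(1−c)²`, `r = c`. The printed second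
hypothesis `|a_kp a_lq| ≤ σ²|a_kq a_lp|` is not used (it follows from the first).

Reference: L. Dubois, *Projective metrics and contraction principles for complex cones*, J. London
Math. Soc. 79 (2009) 719–737, Thm. 1.1, Thm. 2.3, Lemmas 3.1–3.2, Prop. 3.3, Thm. 3.6.
-/

open scoped ComplexConjugate
open Metric Set

namespace Summit.CriticalPhenomena.CardyFormulaZ2.Theorems

namespace ComplexConeContraction

open Literature.Dynamics.Contraction

section Step

variable {θ : ℝ} {m n : ℕ} {A : Matrix (Fin m) (Fin n) ℂ}

/-- `E(Ax, Ay) ⊆ E(x, y)` (first line of the proof of Dubois' Thm. 2.3). -/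
theorem duboisE_mulVec_subset (hθ : 0 < θ) (hθ1 : θ < 1)
    (hA : ∀ k l p q, θ⁻¹ * ‖A k p * A l q - A k q * A l p‖ <
      (conj (A k p) * A l q + conj (A k q) * A l p).re)
    (hn : 0 < n) (x y : Fin n → ℂ) :
    duboisE (rughConeInt m) (A.mulVec x) (A.mulVec y) ⊆ duboisE (rughConeInt n) x y := by
  intro z hz
  by_contra hz'
  simp only [duboisE, mem_setOf_eq, not_not] at hz'
  have h0 : z • x - y ≠ 0 := ne_zero_of_mem_rughConeInt' hn hz'
  have himg := mulVec_mem_rughConeInt hθ hθ1 hA (rughConeInt_subset n hz') h0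
  rw [Matrix.mulVec_sub, Matrix.mulVec_smul] at himg
  exact hz himg

/-- **Inequality (2.12)** of Dubois' proof of Thm. 2.3: for `λ, μ ∉ E(x,y)`, `λ ≠ μ`, and
`α, β ∈ E(Ax, Ay)`, `|μ−α| |λ−β| ≤ Λ |λ−α| |μ−β|` with `Λ = (1+K)⁴`: the points
`(μ−α)/(λ−α)`, `(μ−β)/(λ−β)` both lie in `E(A(λx−y), A(μx−y))`, whose modulus ratio is bounded. -/
theorem moebius_ineq (hθ : 0 < θ) (hθ1 : θ < 1)
    (hA : ∀ k l p q, θ⁻¹ * ‖A k p * A l q - A k q * A l p‖ <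
      (conj (A k p) * A l q + conj (A k q) * A l p).re)
    (hn : 0 < n) {x y : Fin n → ℂ} {lam mu α β : ℂ}
    (hlam : lam ∉ duboisE (rughConeInt n) x y) (hmu : mu ∉ duboisE (rughConeInt n) x y)
    (hne : lam ≠ mu) (hα : α ∈ duboisE (rughConeInt m) (A.mulVec x) (A.mulVec y))
    (hβ : β ∈ duboisE (rughConeInt m) (A.mulVec x) (A.mulVec y)) :
    ‖mu - α‖ * ‖lam - β‖ ≤ (1 + ((1 + θ) / (1 - θ)) ^ 3) ^ 4 * (‖lam - α‖ * ‖mu - β‖) := by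
  have hsub := duboisE_mulVec_subset hθ hθ1 hA hn x y
  have hlam' := hlam
  have hmu' := hmu
  simp only [duboisE, mem_setOf_eq, not_not] at hlam' hmu'
  -- the two new cone vectors
  have hx' : lam • x - y ∈ rughCone n := rughConeInt_subset n hlam'
  have hx'0 : lam • x - y ≠ 0 := ne_zero_of_mem_rughConeInt' hn hlam'
  have hy' : mu • x - y ∈ rughCone n := rughConeInt_subset n hmu'
  have hy'0 : mu • x - y ≠ 0 := ne_zero_of_mem_rughConeInt' hn hmu'
  have hAx' : A.mulVec (lam • x - y) = lam • A.mulVec x - A.mulVec y := by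
    rw [Matrix.mulVec_sub, Matrix.mulVec_smul]
  have hAy' : A.mulVec (mu • x - y) = mu • A.mulVec x - A.mulVec y := by
    rw [Matrix.mulVec_sub, Matrix.mulVec_smul]
  -- the Möbius trick
  have key : ∀ γ, γ ∈ duboisE (rughConeInt m) (A.mulVec x) (A.mulVec y) → lam - γ ≠ 0 ∧
      (mu - γ) / (lam - γ) ∈ duboisE (rughConeInt m) (A.mulVec (lam • x - y))
        (A.mulVec (mu • x - y)) := by
    intro γ hγ
    have hγl : lam - γ ≠ 0 := by
      rw [sub_ne_zero]
      intro h
      rw [h] at hlam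
      exact hlam (hsub hγ)
    refine ⟨hγl, ?_⟩
    have hz : (mu - γ) / (lam - γ) * (lam - γ) = mu - γ := div_mul_cancel₀ _ hγl
    have hz1 : (mu - γ) / (lam - γ) - 1 ≠ 0 := by
      intro h
      have h1 : (mu - γ) / (lam - γ) = 1 := sub_eq_zero.1 h
      rw [h1, one_mul] at hz
      exact hne (by linear_combination hz)
    show ((mu - γ) / (lam - γ)) • A.mulVec (lam • x - y) - A.mulVec (mu • x - y) ∉ rughConeInt m
    rw [hAx', hAy']
    have hid : ((mu - γ) / (lam - γ)) • (lam • A.mulVec x - A.mulVec y) -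
        (mu • A.mulVec x - A.mulVec y) =
        ((mu - γ) / (lam - γ) - 1) • (γ • A.mulVec x - A.mulVec y) := by
      ext i
      simp only [Pi.sub_apply, Pi.smul_apply, smul_eq_mul]
      linear_combination (A.mulVec x i) * hz
    rw [hid]
    exact fun hmem => hγ (mem_rughConeInt_of_smul_mem hz1 hmem)
  obtain ⟨hla, hzα⟩ := key α hα
  obtain ⟨hlb, hzβ⟩ := key β hβ
  have hbound := duboisE_mulVec_ratio_bound hθ hθ1 hA hx' hx'0 hy' hy'0 hzα hzβ
  rw [norm_div, norm_div] at hbound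
  have hla' : 0 < ‖lam - α‖ := norm_pos_iff.2 hla
  have hlb' : 0 < ‖lam - β‖ := norm_pos_iff.2 hlb
  rw [div_le_iff₀ hla'] at hbound
  calc ‖mu - α‖ * ‖lam - β‖
      ≤ ((1 + ((1 + θ) / (1 - θ)) ^ 3) ^ 4 * (‖mu - β‖ / ‖lam - β‖) * ‖lam - α‖) * ‖lam - β‖ :=
        mul_le_mul_of_nonneg_right hbound hlb'.le
    _ = (1 + ((1 + θ) / (1 - θ)) ^ 3) ^ 4 * (‖lam - α‖ * ‖mu - β‖) := by
        field_simp

/-- **Inequality (2.13)** of Dubois' proof of Thm. 2.3, after `m ↑ a`, `M ↓ b`: if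
`E(x,y) ⊆ {a ≤ |z| ≤ b}` with `a > 0`, then for `α, β ∈ E(Ax,Ay)` with `|α| ≤ |β|`,
`(b − |α|)(|β| − a) ≤ Λ (|α| − a)(b − |β|)`. -/
theorem cross_ineq (hθ : 0 < θ) (hθ1 : θ < 1)
    (hA : ∀ k l p q, θ⁻¹ * ‖A k p * A l q - A k q * A l p‖ <
      (conj (A k p) * A l q + conj (A k q) * A l p).re)
    (hn : 0 < n) {x y : Fin n → ℂ} {a b : ℝ} (ha : 0 < a)
    (hE : ∀ z ∈ duboisE (rughConeInt n) x y, a ≤ ‖z‖ ∧ ‖z‖ ≤ b)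
    {α β : ℂ} (hα : α ∈ duboisE (rughConeInt m) (A.mulVec x) (A.mulVec y))
    (hβ : β ∈ duboisE (rughConeInt m) (A.mulVec x) (A.mulVec y)) (hAB : ‖α‖ ≤ ‖β‖) :
    (b - ‖α‖) * (‖β‖ - a) ≤ (1 + ((1 + θ) / (1 - θ)) ^ 3) ^ 4 * ((‖α‖ - a) * (b - ‖β‖)) := by
  have hsub := duboisE_mulVec_subset hθ hθ1 hA hn x y
  have haα : a ≤ ‖α‖ := (hE α (hsub hα)).1
  have hbβ : ‖β‖ ≤ b := (hE β (hsub hβ)).2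
  have hαpos : 0 < ‖α‖ := lt_of_lt_of_le ha haα
  have hβpos : 0 < ‖β‖ := lt_of_lt_of_le hαpos hAB
  apply cross_le_of_forall ha
  intro m' M hm' hm'a hbM
  set lam : ℂ := ((m' / ‖α‖ : ℝ) : ℂ) * α with hlam_def
  set mu : ℂ := ((M / ‖β‖ : ℝ) : ℂ) * β with hmu_def
  have hMpos : 0 < M := by linarith
  have hlam_norm : ‖lam‖ = m' := by
    rw [hlam_def, norm_mul, Complex.norm_real, Real.norm_eq_abs, abs_of_pos (div_pos hm' hαpos),
      div_mul_cancel₀ _ hαpos.ne']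
  have hmu_norm : ‖mu‖ = M := by
    rw [hmu_def, norm_mul, Complex.norm_real, Real.norm_eq_abs, abs_of_pos (div_pos hMpos hβpos),
      div_mul_cancel₀ _ hβpos.ne']
  have hlamE : lam ∉ duboisE (rughConeInt n) x y := fun h => by
    have := (hE lam h).1
    rw [hlam_norm] at this
    linarith
  have hmuE : mu ∉ duboisE (rughConeInt n) x y := fun h => by
    have := (hE mu h).2
    rw [hmu_norm] at this
    linarith
  have hne : lam ≠ mu := fun h => by
    have := congrArg norm h
    rw [hlam_norm, hmu_norm] at this
    linarith
  have hineq := moebius_ineq hθ hθ1 hA hn hlamE hmuE hne hα hβ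
  have h1 : ‖lam - α‖ = ‖α‖ - m' := by
    have e : lam - α = ((m' / ‖α‖ - 1 : ℝ) : ℂ) * α := by rw [hlam_def]; push_cast; ring
    have hnp : m' / ‖α‖ - 1 ≤ 0 := by rw [sub_nonpos, div_le_one hαpos]; linarith
    rw [e, norm_mul, Complex.norm_real, Real.norm_eq_abs, abs_of_nonpos hnp, neg_sub, sub_mul,
      one_mul, div_mul_cancel₀ _ hαpos.ne']
  have h2 : ‖mu - β‖ = M - ‖β‖ := by
    have e : mu - β = ((M / ‖β‖ - 1 : ℝ) : ℂ) * β := by rw [hmu_def]; push_cast; ring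
    have hnn : 0 ≤ M / ‖β‖ - 1 := by rw [sub_nonneg, one_le_div hβpos]; linarith
    rw [e, norm_mul, Complex.norm_real, Real.norm_eq_abs, abs_of_nonneg hnn, sub_mul, one_mul,
      div_mul_cancel₀ _ hβpos.ne']
  have h3 : M - ‖α‖ ≤ ‖mu - α‖ := by
    have := norm_sub_norm_le mu α
    rwa [hmu_norm] at this
  have h4 : ‖β‖ - m' ≤ ‖lam - β‖ := by
    have := norm_sub_norm_le β lam
    rwa [hlam_norm, norm_sub_rev] at this
  have hMA : 0 ≤ M - ‖α‖ := by linarith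
  have hBm : 0 ≤ ‖β‖ - m' := by linarith
  calc (M - ‖α‖) * (‖β‖ - m') ≤ ‖mu - α‖ * ‖lam - β‖ := mul_le_mul h3 h4 hBm (norm_nonneg _)
    _ ≤ (1 + ((1 + θ) / (1 - θ)) ^ 3) ^ 4 * (‖lam - α‖ * ‖mu - β‖) := hineq
    _ = (1 + ((1 + θ) / (1 - θ)) ^ 3) ^ 4 * ((‖α‖ - m') * (M - ‖β‖)) := by rw [h1, h2]

/-- **One contraction step** (Dubois' Thm. 2.3 + Birkhoff's inequality, Remark 1, for `ℂⁿ₊`): if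
`x, y ∈ Int ℂⁿ₊` and `E(x,y) ⊆ {p² ≤ |z| ≤ q²}` (`0 < p ≤ q`), then
`E(Ax,Ay) ⊆ {P² ≤ |z| ≤ Q²}` with `0 < P ≤ Q` and `(Q−P)(q+p)(L+1) ≤ (L−1)(Q+P)(q−p)`,
`L = (1+K)²`, `K = ((1+θ)/(1−θ))³` — i.e. `tanh(δ(Ax,Ay)/4) ≤ tanh(Δ/4) tanh(δ(x,y)/4)`. -/
theorem contraction_step (hθ : 0 < θ) (hθ1 : θ < 1)
    (hA : ∀ k l p q, θ⁻¹ * ‖A k p * A l q - A k q * A l p‖ <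
      (conj (A k p) * A l q + conj (A k q) * A l p).re)
    (hn : 0 < n) (hm : 0 < m) {x y : Fin n → ℂ} (hx : x ∈ rughConeInt n) (hy : y ∈ rughConeInt n)
    {p q : ℝ} (hp : 0 < p) (hpq : p ≤ q)
    (hE : ∀ z ∈ duboisE (rughConeInt n) x y, p ^ 2 ≤ ‖z‖ ∧ ‖z‖ ≤ q ^ 2) :
    ∃ P Q : ℝ, 0 < P ∧ P ≤ Q ∧
      (Q - P) * (q + p) * ((1 + ((1 + θ) / (1 - θ)) ^ 3) ^ 2 + 1) ≤
        ((1 + ((1 + θ) / (1 - θ)) ^ 3) ^ 2 - 1) * ((Q + P) * (q - p)) ∧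
      ∀ z ∈ duboisE (rughConeInt m) (A.mulVec x) (A.mulVec y), P ^ 2 ≤ ‖z‖ ∧ ‖z‖ ≤ Q ^ 2 := by
  have hx0 := ne_zero_of_mem_rughConeInt' hn hx
  have hy0 := ne_zero_of_mem_rughConeInt' hn hy
  have hAx : A.mulVec x ∈ rughConeInt m :=
    mulVec_mem_rughConeInt hθ hθ1 hA (rughConeInt_subset n hx) hx0
  have hAy : A.mulVec y ∈ rughConeInt m :=
    mulVec_mem_rughConeInt hθ hθ1 hA (rughConeInt_subset n hy) hy0
  obtain ⟨α, hα, β, hβ, hαpos, hEb⟩ := exists_norm_bounds_duboisE hm hAx hAy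
  have hAB : ‖α‖ ≤ ‖β‖ := (hEb α hα).2
  have hcross := cross_ineq hθ hθ1 hA hn (by positivity : 0 < p ^ 2) hE hα hβ hAB
  have hsub := duboisE_mulVec_subset hθ hθ1 hA hn x y
  have hpα : p ^ 2 ≤ ‖α‖ := (hE α (hsub hα)).1
  have hβq : ‖β‖ ≤ q ^ 2 := (hE β (hsub hβ)).2
  have hK0 : 0 ≤ ((1 + θ) / (1 - θ)) ^ 3 := pow_nonneg (div_nonneg (by linarith) (by linarith)) 3
  refine ⟨Real.sqrt ‖α‖, Real.sqrt ‖β‖, Real.sqrt_pos.2 hαpos, Real.sqrt_le_sqrt hAB, ?_, ?_⟩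
  · apply birkhoff_sqrt hp ((Real.le_sqrt' hp).2 hpα) (Real.sqrt_le_sqrt hAB)
      (Real.sqrt_le_iff.2 ⟨by linarith, hβq⟩) (by nlinarith)
    rw [Real.sq_sqrt hαpos.le, Real.sq_sqrt (norm_nonneg β)]
    have hL : ((1 + ((1 + θ) / (1 - θ)) ^ 3) ^ 2) ^ 2 = (1 + ((1 + θ) / (1 - θ)) ^ 3) ^ 4 := by ring
    rw [hL]
    exact hcross
  · intro z hz
    rw [Real.sq_sqrt hαpos.le, Real.sq_sqrt (norm_nonneg β)]
    exact hEb z hz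

/-- **The first step** (finite diameter of `A(ℂⁿ₊ ∖ {0})`): for `x, y ∈ ℂⁿ₊ ∖ {0}`,
`E(Ax,Ay) ⊆ {P² ≤ |z| ≤ Q²}` with `0 < P ≤ Q` and `(Q−P)(L+1) ≤ (L−1)(Q+P)`, `L = (1+K)²`. -/
theorem base_annulus (hθ : 0 < θ) (hθ1 : θ < 1)
    (hA : ∀ k l p q, θ⁻¹ * ‖A k p * A l q - A k q * A l p‖ <
      (conj (A k p) * A l q + conj (A k q) * A l p).re)
    (hm : 0 < m) {x y : Fin n → ℂ} (hx : x ∈ rughCone n) (hx0 : x ≠ 0) (hy : y ∈ rughCone n)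
    (hy0 : y ≠ 0) :
    ∃ P Q : ℝ, 0 < P ∧ P ≤ Q ∧
      (Q - P) * ((1 + ((1 + θ) / (1 - θ)) ^ 3) ^ 2 + 1) ≤
        ((1 + ((1 + θ) / (1 - θ)) ^ 3) ^ 2 - 1) * (Q + P) ∧
      ∀ z ∈ duboisE (rughConeInt m) (A.mulVec x) (A.mulVec y), P ^ 2 ≤ ‖z‖ ∧ ‖z‖ ≤ Q ^ 2 := by
  have hAx : A.mulVec x ∈ rughConeInt m := mulVec_mem_rughConeInt hθ hθ1 hA hx hx0
  have hAy : A.mulVec y ∈ rughConeInt m := mulVec_mem_rughConeInt hθ hθ1 hA hy hy0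
  obtain ⟨α, hα, β, hβ, hαpos, hEb⟩ := exists_norm_bounds_duboisE hm hAx hAy
  have hAB : ‖α‖ ≤ ‖β‖ := (hEb α hα).2
  have hK0 : 0 ≤ ((1 + θ) / (1 - θ)) ^ 3 := pow_nonneg (div_nonneg (by linarith) (by linarith)) 3
  have hb : ‖β‖ ≤ ((1 + ((1 + θ) / (1 - θ)) ^ 3) ^ 2) ^ 2 * ‖α‖ := by
    have h := duboisE_mulVec_ratio_bound hθ hθ1 hA hx hx0 hy hy0 hβ hα
    have hL : ((1 + ((1 + θ) / (1 - θ)) ^ 3) ^ 2) ^ 2 = (1 + ((1 + θ) / (1 - θ)) ^ 3) ^ 4 := by ring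
    rw [hL]
    exact h
  refine ⟨Real.sqrt ‖α‖, Real.sqrt ‖β‖, Real.sqrt_pos.2 hαpos, Real.sqrt_le_sqrt hAB,
    sqrt_ratio_aux (by positivity) hb, ?_⟩
  intro z hz
  rw [Real.sq_sqrt hαpos.le, Real.sq_sqrt (norm_nonneg β)]
  exact hEb z hz

end Step

end ComplexConeContraction

open Literature.Dynamics.Contraction ComplexConeContraction

/-- **The engine of route CardyComplexCone** (item stmt-CriticalPhenomena-8789): Dubois' complex
Birkhoff contraction for sequential products of matrices satisfying the 2×2 aperture condition,
read on test-vector cross-ratios. See the module docstring for the proof outline. -/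
theorem complexConeContraction_proof :
    Summit.CriticalPhenomena.CardyFormulaZ2.Theses.CardyComplexCone.ComplexConeContraction := by
  unfold Summit.CriticalPhenomena.CardyFormulaZ2.Theses.CardyComplexCone.ComplexConeContraction
  intro θ σ hθ hθ1 _hσ
  -- the constants
  obtain ⟨K, hK⟩ : ∃ K : ℝ, K = ((1 + θ) / (1 - θ)) ^ 3 := ⟨_, rfl⟩
  obtain ⟨L, hL⟩ : ∃ L : ℝ, L = (1 + K) ^ 2 := ⟨_, rfl⟩
  obtain ⟨c, hc⟩ : ∃ c : ℝ, c = (L - 1) / (L + 1) := ⟨_, rfl⟩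
  have hK0 : 0 ≤ K := by rw [hK]; exact pow_nonneg (div_nonneg (by linarith) (by linarith)) 3
  have hL1 : 1 ≤ L := by rw [hL]; nlinarith
  have hc0 : 0 ≤ c := by rw [hc]; exact div_nonneg (by linarith) (by linarith)
  have hc1 : c < 1 := by rw [hc, div_lt_one (by linarith)]; linarith
  have h1c : 0 < 1 - c := by linarith
  refine ⟨12 / (1 - c) ^ 2, c, by positivity, hc0, hc1, ?_⟩
  intro n A hn hA x y hxA hyA hx0 hy0 hxK hyK m hm f g hf0 hg0 hfK hgK
  -- hypotheses in the Literature vocabulary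
  have hA' : ∀ j (k l : Fin (n (j + 1))) (p q : Fin (n j)),
      θ⁻¹ * ‖A j k p * A j l q - A j k q * A j l p‖ <
        (conj (A j k p) * A j l q + conj (A j k q) * A j l p).re :=
    fun j k l p q => (hA j k l p q).1
  have hx0K : x 0 ∈ rughCone (n 0) := fun k l => hxK k l
  have hy0K : y 0 ∈ rughCone (n 0) := fun k l => hyK k l
  have hfK' : f ∈ rughCone (n m) := fun k l => hfK k l
  have hgK' : g ∈ rughCone (n m) := fun k l => hgK k l
  -- the invariant: interior + annulus `[p², q²] ⊇ E(x_j, y_j)` with `tanh(δ/4) ≤ c^j`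
  have inv : ∀ j, 1 ≤ j → x j ∈ rughConeInt (n j) ∧ y j ∈ rughConeInt (n j) ∧
      ∃ p q : ℝ, 0 < p ∧ p ≤ q ∧ q - p ≤ c ^ j * (q + p) ∧
        ∀ z ∈ duboisE (rughConeInt (n j)) (x j) (y j), p ^ 2 ≤ ‖z‖ ∧ ‖z‖ ≤ q ^ 2 := by
    intro j hj
    induction j, hj using Nat.le_induction with
    | base =>
      have hx1 : x 1 = (A 0).mulVec (x 0) := hxA 0
      have hy1 : y 1 = (A 0).mulVec (y 0) := hyA 0
      refine ⟨?_, ?_, ?_⟩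
      · rw [hx1]; exact mulVec_mem_rughConeInt hθ hθ1 (hA' 0) hx0K hx0
      · rw [hy1]; exact mulVec_mem_rughConeInt hθ hθ1 (hA' 0) hy0K hy0
      · obtain ⟨P, Q, hP, hPQ, hbase, hE⟩ :=
          base_annulus hθ hθ1 (hA' 0) (hn 1) hx0K hx0 hy0K hy0
        rw [← hK, ← hL] at hbase
        refine ⟨P, Q, hP, hPQ, ?_, ?_⟩
        · rw [pow_one, hc, div_mul_eq_mul_div, le_div_iff₀ (by linarith)]
          linarith
        · rw [hx1, hy1]
          exact hE
    | succ j hj ih =>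
      obtain ⟨hxj, hyj, p, q, hp, hpq, hclose, hE⟩ := ih
      have hxj1 : x (j + 1) = (A j).mulVec (x j) := hxA j
      have hyj1 : y (j + 1) = (A j).mulVec (y j) := hyA j
      obtain ⟨P, Q, hP, hPQ, hbirk, hE'⟩ :=
        contraction_step hθ hθ1 (hA' j) (hn j) (hn (j + 1)) hxj hyj hp hpq hE
      rw [← hK, ← hL] at hbirk
      refine ⟨?_, ?_, P, Q, hP, hPQ, ?_, ?_⟩
      · rw [hxj1]
        exact mulVec_mem_rughConeInt hθ hθ1 (hA' j) (rughConeInt_subset _ hxj)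
          (ne_zero_of_mem_rughConeInt' (hn j) hxj)
      · rw [hyj1]
        exact mulVec_mem_rughConeInt hθ hθ1 (hA' j) (rughConeInt_subset _ hyj)
          (ne_zero_of_mem_rughConeInt' (hn j) hyj)
      · have hqp : 0 < q + p := by linarith
        have h1 : (Q - P) * (q + p) ≤ c * ((Q + P) * (q - p)) := by
          rw [hc, div_mul_eq_mul_div, le_div_iff₀ (by linarith)]
          linarith
        have h2 : c * ((Q + P) * (q - p)) ≤ c * ((Q + P) * (c ^ j * (q + p))) :=
          mul_le_mul_of_nonneg_left (mul_le_mul_of_nonneg_left hclose (by linarith)) hc0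
        have h3 : (Q - P) * (q + p) ≤ (c ^ (j + 1) * (Q + P)) * (q + p) := by
          calc (Q - P) * (q + p) ≤ c * ((Q + P) * (c ^ j * (q + p))) := h1.trans h2
            _ = (c ^ (j + 1) * (Q + P)) * (q + p) := by ring
        exact le_of_mul_le_mul_right h3 hqp
      · rw [hxj1, hyj1]
        exact hE'
  -- read the annulus at time `m` on the test vectors
  obtain ⟨hxm, hym, p, q, hp, hpq, hclose, hE⟩ := inv m hm
  have hXf : ∑ k, f k * x m k ≠ 0 := sum_mul_ne_zero hfK' hf0 hxm
  have hYf : ∑ k, f k * y m k ≠ 0 := sum_mul_ne_zero hfK' hf0 hym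
  have hXg : ∑ k, g k * x m k ≠ 0 := sum_mul_ne_zero hgK' hg0 hxm
  have hYg : ∑ k, g k * y m k ≠ 0 := sum_mul_ne_zero hgK' hg0 hym
  have hzf := pairing_ratio_mem_duboisE (y := y m) hxm hfK' hf0
  have hzg := pairing_ratio_mem_duboisE (y := y m) hxm hgK' hg0
  set zf := (∑ k, f k * y m k) / (∑ k, f k * x m k) with hzf_def
  set zg := (∑ k, g k * y m k) / (∑ k, g k * x m k) with hzg_def
  have hzf0 : zf ≠ 0 := div_ne_zero hYf hXf
  have hquot : (∑ k, f k * x m k) * (∑ k, g k * y m k) /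
      ((∑ k, f k * y m k) * (∑ k, g k * x m k)) - 1 = (zg - zf) / zf := by
    rw [hzf_def, hzg_def]
    field_simp
  rw [hquot, norm_div]
  have hnum : ‖zg - zf‖ ≤ 3 * (q ^ 2 - p ^ 2) :=
    norm_sub_le_three_mul hxm (by positivity) hE hzg hzf
  have hden : p ^ 2 ≤ ‖zf‖ := (hE zf hzf).1
  have hzfpos : 0 < ‖zf‖ := norm_pos_iff.2 hzf0
  have hcm : c ^ m ≤ c := pow_le_of_le_one hc0 hc1.le (by omega)
  have harith := final_arith hp hpq (pow_nonneg hc0 m) hcm hc1 hclose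
  rw [div_le_iff₀ hzfpos]
  calc ‖zg - zf‖ ≤ 3 * (q ^ 2 - p ^ 2) := hnum
    _ ≤ 12 * c ^ m * p ^ 2 / (1 - c) ^ 2 := by
        rw [le_div_iff₀ (by positivity)]
        linarith
    _ ≤ 12 * c ^ m * ‖zf‖ / (1 - c) ^ 2 := by
        apply div_le_div_of_nonneg_right _ (by positivity)
        exact mul_le_mul_of_nonneg_left hden (by positivity)
    _ = 12 / (1 - c) ^ 2 * c ^ m * ‖zf‖ := by
        field_simp

end Summit.CriticalPhenomena.CardyFormulaZ2.Theorems
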